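import Literature.NumberTheory.Sieve.HardyLittlewoodChowlaFourier
import Literature.NumberTheory.Sieve.LinearFormsRoughTupleBound
import Literature.NumberTheory.Sieve.CircleMethodKernel
import HarnessLib

/-!
# Hardy–Littlewood–Chowla on average (Lichtman–Teräväinen 2022): moments of prime-tuple sums, I

Topic `Literature/NumberTheory/Sieve`, companion of `HardyLittlewoodChowla.lean` (the named facts
`lichtmanTeravainen2022_hlc_avg(_liouville)` = J. D. Lichtman, J. Teräväinen, *On the
Hardy–Littlewood–Chowla conjecture on average*, Forum Math. Sigma 10 (2022) e57, arXiv:2111.08912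
[LichtmanTeravainen2022], Theorem 1.2 (i)).  Everything in this file is PROVED; it introduces no
definition and no named fact.

This file prepares the proof of **Proposition 2.7** of the paper (held copy `paper:arxiv-2111.08912`,
§2.2: "`M_{2k} := ∫₀^X ∫₀¹ |∑_{x ≤ n ≤ x+H} g(n) e(αn) ∏_j Λ(n+a_j)|^{2k} dα dx
≪ X (H^{2k-1} + H^k (log X)^{kℓ} + H (log X)^{(2k-1)ℓ})`") in the discrete setting of
`HardyLittlewoodChowlaFourier.lean` (integer windows `(k - 2H, k]`, `k ∈ [1, X + 2H]`), following the
printed proof: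

* `integral_norm_pow_le_sum_balanced` — display (2.7)/(2.8): "Expanding out the definition of
  `M_{2k}` using orthogonality … and so `|g(n)| ≤ 1` implies
  `M_{2k} ≤ ∑_{n₁+⋯+n_k = n_{k+1}+⋯+n_{2k}} ∏ Λ(nᵢ + a_j) · ∫ 𝟙 …`": for one window `W`,
  `∫₀¹ |∑_{n ∈ W} c(n) e(-nα)|^{2j} dα ≤ ∑_{(t,t') ∈ W^j × W^j, ∑ tᵢ = ∑ t'ᵢ} ∏ v(tᵢ) ∏ v(t'ᵢ)` whenever
  `|c| ≤ v`;
* `sum_windows_le_line` — "For each `n₁, …, n_{2k}` denote `M = max |nᵢ - n_j|`, so that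
  `∫₀^X 𝟙_{x ≤ n₁ ≤ x+H} ⋯ dx ≤ H 𝟙_{0 ≤ M < H}`, and if we let `n = n_{2k}`, `hᵢ = nᵢ - n` …": the sum
  over the windows of the balanced tuples is at most `2H` times the sum over a base point `n ≤ X` and
  over the balanced offset patterns `(e, e') ∈ [1, 4H-1]^j × [1, 4H-1]^j` with `e'_j = 2H` (offsets
  shifted by `2H` to be positive) of `∏ᵢ Λv(n + eᵢ) ∏ᵢ Λv(n + e'ᵢ)`, for weights `v ≤ Λv` supported
  on `[2H, X]`;
* `sum_prod_vonMangoldt_le_of_card_image` — the input of Lemma 2.3 of the paper ("A well-known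
  application of Selberg's sieve upper bounds the number of `k`-tuples of primes"), here in CRUDE
  form from the tree's uniform upper-bound sieve for rough values of linear forms
  (`Literature.NumberTheory.Sieve.uniformRoughTupleBound`, with the singular series absorbed into a
  power of `log log X`), but for families of shifts WITH REPETITIONS: for a family of `M` shifts
  `1 ≤ y_q ≤ X` with `s` distinct values, `∑_{n ≤ X} ∏_q Λ(n + y_q) ≤ C X (log log X)^M (log X)^{M - s}`
  for `X ≥ X₀(M)` — each coincidence among the shifts costs a factor `log X`, as in display (2.9) of
  the paper.  (The sharp form for distinct shifts, with the singular series of Lemma 2.4, is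
  `LichtmanTeravainen2022.sum_prod_vonMangoldt_le` of `HardyLittlewoodChowlaSieve.lean`; the crude
  form suffices inside the `1/(2j)`-th root taken in Proposition 3.2.)

The combinatorial count of the offset patterns is `HardyLittlewoodChowlaTuples.lean`; the assembly of
Proposition 2.7 is `HardyLittlewoodChowlaMoments.lean`.

## References

* J. D. Lichtman, J. Teräväinen, Forum Math. Sigma 10 (2022) e57, arXiv:2111.08912, §2.2,
  Lemma 2.3, Proposition 2.7 and its proof. [cite: LichtmanTeravainen2022, Proposition 2.7]
-/

open Finset MeasureTheory
open scoped FourierTransform ComplexConjugate ArithmeticFunction.vonMangoldt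

namespace Literature.NumberTheory.Sieve.LichtmanTeravainen2022

open Literature.NumberTheory.Sieve.Lichtman2020 (continuous_fourierChar_mul norm_fourierChar)
open Literature.NumberTheory.Sieve.CircleMethodKernel (fourierChar_coe_mul conj_fourierChar_coe)

/-! ### Characters of sums -/

/-- `e(∑ xᵢ) = ∏ e(xᵢ)`. [folklore] -/
theorem coe_fourierChar_sum {ι : Type*} [DecidableEq ι] (s : Finset ι) (x : ι → ℝ) :
    (𝐞 (∑ i ∈ s, x i) : ℂ) = ∏ i ∈ s, (𝐞 (x i) : ℂ) := by
  induction s using Finset.induction_on with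
  | empty => simp
  | insert a s ha ih =>
    rw [Finset.sum_insert ha, Finset.prod_insert ha, AddChar.map_add_eq_mul, Circle.coe_mul, ih]

/-! ### Expansion of the `2j`-th moment (orthogonality) -/

/-- The `j`-th power of a trigonometric sum with frequencies `-n`:
`(∑_{n ∈ W} c(n) e(-nα))^j = ∑_{t ∈ W^j} (∏ᵢ c(tᵢ)) e(-(∑ᵢ tᵢ) α)`. [folklore] -/
theorem trigSum_pow_eq (W : Finset ℕ) (c : ℕ → ℂ) (j : ℕ) (α : ℝ) :
    (∑ n ∈ W, c n * (𝐞 (-((n : ℝ) * α)) : ℂ)) ^ j =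
      ∑ t ∈ Fintype.piFinset (fun _ : Fin j => W),
        (∏ i, c (t i)) * (𝐞 (-((∑ i, (t i : ℝ)) * α)) : ℂ) := by
  rw [← Fin.prod_const j, Finset.prod_univ_sum (fun _ : Fin j => W)
    (fun _ n => c n * (𝐞 (-((n : ℝ) * α)) : ℂ))]
  refine Finset.sum_congr rfl fun t _ => ?_
  rw [Finset.prod_mul_distrib, ← coe_fourierChar_sum]
  congr 2
  rw [Finset.sum_mul, ← Finset.sum_neg_distrib]

/-- **Display (2.7)–(2.8) of [LichtmanTeravainen2022]** (one window): for `|c| ≤ v`,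
`∫₀¹ |∑_{n ∈ W} c(n) e(-nα)|^{2j} dα ≤ ∑_{(t, t') ∈ W^j × W^j, ∑ᵢ tᵢ = ∑ᵢ t'ᵢ} ∏ᵢ v(tᵢ) ∏ᵢ v(t'ᵢ)`
(expand the `2j`-th power and integrate with `∫₀¹ e(nα) dα = [n = 0]`).
[cite: LichtmanTeravainen2022, Proposition 2.7 (proof)] -/
theorem integral_norm_pow_le_sum_balanced (W : Finset ℕ) (c : ℕ → ℂ) (v : ℕ → ℝ)
    (hcv : ∀ n, ‖c n‖ ≤ v n) (j : ℕ) :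
    ∫ α in (0 : ℝ)..1, ‖∑ n ∈ W, c n * (𝐞 (-((n : ℝ) * α)) : ℂ)‖ ^ (2 * j) ≤
      ∑ p ∈ ((Fintype.piFinset fun _ : Fin j => W) ×ˢ (Fintype.piFinset fun _ : Fin j => W)).filter
          (fun p => ∑ i, p.1 i = ∑ i, p.2 i),
        (∏ i, v (p.1 i)) * ∏ i, v (p.2 i) := by
  set P := Fintype.piFinset (fun _ : Fin j => W) with hP
  set S : ℝ → ℂ := fun α => ∑ n ∈ W, c n * (𝐞 (-((n : ℝ) * α)) : ℂ) with hS
  set coef : ((Fin j → ℕ) × (Fin j → ℕ)) → ℂ := fun p => (∏ i, c (p.1 i)) * conj (∏ i, c (p.2 i))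
    with hcoef
  set freq : ((Fin j → ℕ) × (Fin j → ℕ)) → ℤ := fun p => (∑ i, (p.2 i : ℤ)) - ∑ i, (p.1 i : ℤ)
    with hfreq
  -- pointwise expansion of `‖S‖^{2j}` as a trigonometric sum
  have hpt : ∀ α : ℝ, (((‖S α‖ ^ (2 * j) : ℝ)) : ℂ) =
      ∑ p ∈ P ×ˢ P, coef p * (𝐞 ((freq p : ℝ) * α) : ℂ) := by
    intro α
    have h1 : (((‖S α‖ ^ (2 * j) : ℝ)) : ℂ) = S α ^ j * conj (S α ^ j) := by
      rw [Complex.mul_conj, Complex.normSq_eq_norm_sq, norm_pow, ← pow_mul, mul_comm j 2]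
    rw [h1, hS]
    simp only
    rw [trigSum_pow_eq, map_sum, Finset.sum_mul_sum, Finset.sum_product]
    refine Finset.sum_congr rfl fun t _ => Finset.sum_congr rfl fun t' _ => ?_
    rw [map_mul, map_prod, conj_fourierChar_coe]
    have h2 : ((freq (t, t') : ℤ) : ℝ) * α = -((∑ i, (t i : ℝ)) * α) + (∑ i, (t' i : ℝ)) * α := by
      simp only [hfreq]; push_cast; ring
    rw [h2, ← fourierChar_coe_mul]
    simp only [hcoef, map_prod]
    ring
  -- integrate
  have hcont : ∀ p, Continuous fun α : ℝ => coef p * (𝐞 ((freq p : ℝ) * α) : ℂ) := fun p =>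
    continuous_const.mul (continuous_fourierChar_mul _)
  have horth : ∀ n : ℤ, ∫ α in (0 : ℝ)..1, (𝐞 (n * α) : ℂ) = if n = 0 then 1 else 0 :=
    integral_fourierChar_intCast_holds
  have hint : ((∫ α in (0 : ℝ)..1, ‖S α‖ ^ (2 * j) : ℝ) : ℂ) =
      ∑ p ∈ (P ×ˢ P).filter (fun p => ∑ i, p.1 i = ∑ i, p.2 i), coef p := by
    rw [← intervalIntegral.integral_ofReal]
    simp_rw [hpt]
    rw [intervalIntegral.integral_finsetSum fun p _ => (hcont p).intervalIntegrable 0 1]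
    simp_rw [intervalIntegral.integral_const_mul, horth, mul_ite, mul_one, mul_zero]
    rw [Finset.sum_ite, Finset.sum_const_zero, add_zero]
    refine Finset.sum_congr ?_ fun _ _ => rfl
    ext p
    simp only [Finset.mem_filter, hfreq, sub_eq_zero, and_congr_right_iff]
    intro _
    constructor
    · intro h; exact_mod_cast h.symm
    · intro h; exact_mod_cast h.symm
  -- take norms
  have hreal : ∫ α in (0 : ℝ)..1, ‖S α‖ ^ (2 * j) =
      ‖((∫ α in (0 : ℝ)..1, ‖S α‖ ^ (2 * j) : ℝ) : ℂ)‖ := by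
    rw [Complex.norm_real, Real.norm_eq_abs, abs_of_nonneg]
    exact intervalIntegral.integral_nonneg zero_le_one fun α _ => by positivity
  rw [hreal, hint]
  refine (norm_sum_le _ _).trans (Finset.sum_le_sum fun p _ => ?_)
  simp only [hcoef]
  rw [norm_mul, Complex.norm_conj, norm_prod, norm_prod]
  exact mul_le_mul (Finset.prod_le_prod (fun i _ => norm_nonneg _) fun i _ => hcv _)
    (Finset.prod_le_prod (fun i _ => norm_nonneg _) fun i _ => hcv _)
    (Finset.prod_nonneg fun i _ => norm_nonneg _)
    (Finset.prod_nonneg fun i _ => (norm_nonneg _).trans (hcv _))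

/-! ### From windows to a base point and an offset pattern -/

/-- A real-valued comparison of sums along an injection (the tree has several private copies; this
is the form used here). [folklore] -/
theorem sum_le_sum_of_injOn_nn {ι κ : Type*} [DecidableEq κ] (s : Finset ι) (t : Finset κ)
    (e : ι → κ) (f : ι → ℝ) (g : κ → ℝ) (he : Set.InjOn e s) (hst : ∀ i ∈ s, e i ∈ t)
    (hg : ∀ k ∈ t, 0 ≤ g k) (hfg : ∀ i ∈ s, f i ≤ g (e i)) : ∑ i ∈ s, f i ≤ ∑ k ∈ t, g k := by
  calc ∑ i ∈ s, f i ≤ ∑ i ∈ s, g (e i) := Finset.sum_le_sum hfg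
    _ = ∑ k ∈ s.image e, g k := (Finset.sum_image he).symm
    _ ≤ ∑ k ∈ t, g k :=
        Finset.sum_le_sum_of_subset_of_nonneg (Finset.image_subset_iff.2 hst) fun k hk _ => hg k hk

/-- **"∫₀^X 𝟙_{x ≤ n₁ ≤ x+H} ⋯ 𝟙_{x ≤ n_{2k} ≤ x+H} dx ≤ H 𝟙_{0 ≤ M < H}" and "`hᵢ = nᵢ - n`"**
[LichtmanTeravainen2022, proof of Prop. 2.7], discrete form.  Let `v ≤ Λv` be nonnegative weights
with `v` supported on `[2H, X]`.  Summing over the windows `(k - 2H, k]`, `k ∈ [1, X + 2H]`, the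
balanced pairs of `j`-tuples in the window weighted by `∏ v(tᵢ) ∏ v(t'ᵢ)` gives at most `2H` times
the sum, over a base point `0 ≤ n ≤ X` and a balanced offset pattern
`(e, e') ∈ [1, 4H-1]^j × [1, 4H-1]^j` with last coordinate `e'_{j} = 2H`, of
`∏ᵢ Λv(n + eᵢ) ∏ᵢ Λv(n + e'ᵢ)` (each tuple lies in at most `2H` windows, all its entries are within
`2H` of the base entry `n + 2H = t'_j`, and `v ≤ Λv`).
[cite: LichtmanTeravainen2022, Proposition 2.7 (proof)] -/
theorem sum_windows_le_line (X H j : ℕ) (hj : 1 ≤ j) (v Λv : ℕ → ℝ)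
    (hv0 : ∀ n, 0 ≤ v n) (hΛ0 : ∀ n, 0 ≤ Λv n) (hvΛ : ∀ n, v n ≤ Λv n)
    (hsupp : ∀ n, v n ≠ 0 → 2 * H ≤ n ∧ n ≤ X) :
    ∑ k ∈ Icc 1 (X + 2 * H),
      ∑ p ∈ ((Fintype.piFinset fun _ : Fin j => Ioc (k - 2 * H) k) ×ˢ
          (Fintype.piFinset fun _ : Fin j => Ioc (k - 2 * H) k)).filter
            (fun p => ∑ i, p.1 i = ∑ i, p.2 i),
        (∏ i, v (p.1 i)) * ∏ i, v (p.2 i) ≤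
      (2 * H : ℝ) * ∑ q ∈ (range (X + 1)) ×ˢ
          (((Fintype.piFinset fun _ : Fin j => Icc 1 (4 * H - 1)) ×ˢ
            (Fintype.piFinset fun _ : Fin j => Icc 1 (4 * H - 1))).filter
              (fun e => ∑ i, e.1 i = ∑ i, e.2 i ∧ e.2 ⟨j - 1, by omega⟩ = 2 * H)),
        (∏ i, Λv (q.1 + q.2.1 i)) * ∏ i, Λv (q.1 + q.2.2 i) := by
  classical
  set L : ℕ := 2 * H with hL
  set ilast : Fin j := ⟨j - 1, by omega⟩ with hilast
  set K : Finset ℕ := Icc 1 (X + L) with hK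
  set Pk : ℕ → Finset ((Fin j → ℕ) × (Fin j → ℕ)) := fun k =>
    (Fintype.piFinset fun _ : Fin j => Ioc (k - L) k) ×ˢ (Fintype.piFinset fun _ : Fin j => Ioc (k - L) k)
    with hPk
  set P : Finset ((Fin j → ℕ) × (Fin j → ℕ)) :=
    (Fintype.piFinset fun _ : Fin j => Icc 1 (X + L)) ×ˢ (Fintype.piFinset fun _ : Fin j => Icc 1 (X + L))
    with hP
  set bal : (Fin j → ℕ) × (Fin j → ℕ) → Prop := fun p => ∑ i, p.1 i = ∑ i, p.2 i with hbal
  set f : (Fin j → ℕ) × (Fin j → ℕ) → ℝ := fun p => (∏ i, v (p.1 i)) * ∏ i, v (p.2 i) with hf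
  set E : Finset ((Fin j → ℕ) × (Fin j → ℕ)) :=
    ((Fintype.piFinset fun _ : Fin j => Icc 1 (2 * L - 1)) ×ˢ
      (Fintype.piFinset fun _ : Fin j => Icc 1 (2 * L - 1))).filter
        (fun e => ∑ i, e.1 i = ∑ i, e.2 i ∧ e.2 ilast = L) with hE
  set g : ℕ × ((Fin j → ℕ) × (Fin j → ℕ)) → ℝ := fun q =>
    (∏ i, Λv (q.1 + q.2.1 i)) * ∏ i, Λv (q.1 + q.2.2 i) with hg
  have hf0 : ∀ p, 0 ≤ f p := fun p =>
    mul_nonneg (Finset.prod_nonneg fun i _ => hv0 _) (Finset.prod_nonneg fun i _ => hv0 _)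
  have hg0 : ∀ q, 0 ≤ g q := fun q =>
    mul_nonneg (Finset.prod_nonneg fun i _ => hΛ0 _) (Finset.prod_nonneg fun i _ => hΛ0 _)
  have h4H : 4 * H - 1 = 2 * L - 1 := by rw [hL]; omega
  -- Step 1: rewrite each window sum as a sum over `P` with an indicator
  have hPkP : ∀ k ∈ K, Pk k ⊆ P := by
    intro k hk p hp
    simp only [hPk, hP, Finset.mem_product, Fintype.mem_piFinset, Finset.mem_Ioc,
      Finset.mem_Icc, hK] at hp hk ⊢
    exact ⟨fun i => ⟨by have := (hp.1 i).1; omega, by have := (hp.1 i).2; omega⟩,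
      fun i => ⟨by have := (hp.2 i).1; omega, by have := (hp.2 i).2; omega⟩⟩
  have step1 : ∀ k ∈ K, ∑ p ∈ (Pk k).filter bal, f p =
      ∑ p ∈ P.filter bal, if p ∈ Pk k then f p else 0 := by
    intro k hk
    rw [← Finset.sum_filter]
    refine Finset.sum_congr ?_ fun _ _ => rfl
    ext p
    simp only [Finset.mem_filter]
    constructor
    · rintro ⟨h1, h2⟩; exact ⟨⟨hPkP k hk h1, h2⟩, h1⟩
    · rintro ⟨⟨-, h2⟩, h1⟩; exact ⟨h1, h2⟩
  rw [Finset.sum_congr rfl step1, Finset.sum_comm]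
  -- Step 2: count the windows containing a given tuple
  have step2 : ∀ p ∈ P.filter bal, ∑ k ∈ K, (if p ∈ Pk k then f p else 0) ≤
      (L : ℝ) * (if (∀ i, (p.2 ilast < p.1 i + L ∧ p.1 i < p.2 ilast + L) ∧
          (p.2 ilast < p.2 i + L ∧ p.2 i < p.2 ilast + L)) ∧ (∀ i, L ≤ p.1 i ∧ L ≤ p.2 i)
        then f p else 0) := by
    intro p _
    rw [Finset.sum_ite, Finset.sum_const_zero, add_zero, Finset.sum_const, nsmul_eq_mul]
    by_cases hfp : f p = 0
    · rw [hfp, mul_zero]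
      split_ifs <;> simp
    · -- `f p ≠ 0`: all entries are in the support of `v`
      have hbig : ∀ i, L ≤ p.1 i ∧ L ≤ p.2 i := by
        intro i
        simp only [hf] at hfp
        obtain ⟨h1, h2⟩ := mul_ne_zero_iff.1 hfp
        rw [Finset.prod_ne_zero_iff] at h1 h2
        exact ⟨(hsupp _ (h1 i (Finset.mem_univ _))).1, (hsupp _ (h2 i (Finset.mem_univ _))).1⟩
      rcases (K.filter fun k => p ∈ Pk k).eq_empty_or_nonempty with he | ⟨k₀, hk₀⟩
      · rw [he]; simp only [Finset.card_empty, Nat.cast_zero, zero_mul]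
        split_ifs
        · exact mul_nonneg (Nat.cast_nonneg _) (hf0 p)
        · simp
      · have hk₀' := (Finset.mem_filter.1 hk₀).2
        simp only [hPk, Finset.mem_product, Fintype.mem_piFinset, Finset.mem_Ioc] at hk₀'
        have hnear : ∀ i, (p.2 ilast < p.1 i + L ∧ p.1 i < p.2 ilast + L) ∧
            (p.2 ilast < p.2 i + L ∧ p.2 i < p.2 ilast + L) := by
          intro i
          have h1 := hk₀'.1 i
          have h2 := hk₀'.2 i
          have h3 := hk₀'.2 ilast
          omega
        rw [if_pos ⟨hnear, hbig⟩]
        refine mul_le_mul_of_nonneg_right ?_ (hf0 p)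
        have hsub : (K.filter fun k => p ∈ Pk k) ⊆ Ico (p.2 ilast) (p.2 ilast + L) := by
          intro k hk
          have hk' := (Finset.mem_filter.1 hk).2
          simp only [hPk, Finset.mem_product, Fintype.mem_piFinset, Finset.mem_Ioc] at hk'
          have h3 := hk'.2 ilast
          rw [Finset.mem_Ico]
          omega
        calc ((#(K.filter fun k => p ∈ Pk k) : ℕ) : ℝ) ≤ #(Ico (p.2 ilast) (p.2 ilast + L)) := by
              exact_mod_cast Finset.card_le_card hsub
          _ = L := by rw [Nat.card_Ico, Nat.add_sub_cancel_left]
  refine (Finset.sum_le_sum step2).trans ?_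
  rw [← Finset.mul_sum, ← Finset.sum_filter]
  have hLr : ((L : ℕ) : ℝ) = 2 * H := by rw [hL]; push_cast; ring
  rw [hLr]
  refine mul_le_mul_of_nonneg_left ?_ (by positivity)
  -- Step 3: the injection into (base point) × (offset pattern)
  set Q := (P.filter bal).filter (fun p => (∀ i, (p.2 ilast < p.1 i + L ∧ p.1 i < p.2 ilast + L) ∧
      (p.2 ilast < p.2 i + L ∧ p.2 i < p.2 ilast + L)) ∧ (∀ i, L ≤ p.1 i ∧ L ≤ p.2 i)) with hQ
  set φ : (Fin j → ℕ) × (Fin j → ℕ) → ℕ × ((Fin j → ℕ) × (Fin j → ℕ)) := fun p =>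
    (p.2 ilast - L, (fun i => p.1 i + L - p.2 ilast, fun i => p.2 i + L - p.2 ilast)) with hφ
  have hmem : ∀ p ∈ Q, p ∈ P ∧ bal p ∧ (∀ i, (p.2 ilast < p.1 i + L ∧ p.1 i < p.2 ilast + L) ∧
      (p.2 ilast < p.2 i + L ∧ p.2 i < p.2 ilast + L)) ∧ (∀ i, L ≤ p.1 i ∧ L ≤ p.2 i) := by
    intro p hp
    simp only [hQ, Finset.mem_filter] at hp
    exact ⟨hp.1.1, hp.1.2, hp.2.1, hp.2.2⟩
  have hrw : (range (X + 1)) ×ˢ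
      (((Fintype.piFinset fun _ : Fin j => Icc 1 (4 * H - 1)) ×ˢ
        (Fintype.piFinset fun _ : Fin j => Icc 1 (4 * H - 1))).filter
          (fun e => ∑ i, e.1 i = ∑ i, e.2 i ∧ e.2 ⟨j - 1, by omega⟩ = 2 * H)) =
      (range (X + 1)) ×ˢ E := by
    rw [h4H]
  rw [hrw]
  refine sum_le_sum_of_injOn_nn Q ((range (X + 1)) ×ˢ E) φ f g ?_ ?_ (fun q _ => hg0 q) ?_
  · -- injectivity
    intro p hp p' hp' heq
    obtain ⟨-, -, hnear, hbig⟩ := hmem p hp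
    obtain ⟨-, -, hnear', hbig'⟩ := hmem p' hp'
    simp only [hφ, Prod.mk.injEq] at heq
    obtain ⟨h0, h1, h2⟩ := heq
    have hb0 : p.2 ilast = p'.2 ilast := by
      have := (hbig ilast).2; have := (hbig' ilast).2; omega
    refine Prod.ext (funext fun i => ?_) (funext fun i => ?_)
    · have h5 : p.1 i + L - p.2 ilast = p'.1 i + L - p'.2 ilast := congrFun h1 i
      have h3 := (hnear i).1; have h4 := (hnear' i).1
      omega
    · have h5 : p.2 i + L - p.2 ilast = p'.2 i + L - p'.2 ilast := congrFun h2 i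
      have h3 := (hnear i).2; have h4 := (hnear' i).2
      omega
  · -- maps into the target
    intro p hp
    obtain ⟨hpP, hpb, hnear, hbig⟩ := hmem p hp
    simp only [hP, Finset.mem_product, Fintype.mem_piFinset, Finset.mem_Icc] at hpP
    simp only [hφ, hE, Finset.mem_product, Finset.mem_range, Finset.mem_filter,
      Fintype.mem_piFinset, Finset.mem_Icc]
    refine ⟨?_, ⟨fun i => ?_, fun i => ?_⟩, ?_, ?_⟩
    · have := (hpP.2 ilast).2; omega
    · have := (hnear i).1; omega
    · have := (hnear i).2; omega
    · -- balance is preserved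
      have hcast : ∀ a : ℕ, p.2 ilast < a + L → (((a + L - p.2 ilast : ℕ) : ℤ)) = (a : ℤ) + L - p.2 ilast := by
        intro a ha; push_cast [Nat.cast_sub (le_of_lt ha)]; ring
      have h1 : ((∑ i, (p.1 i + L - p.2 ilast) : ℕ) : ℤ) = ((∑ i, (p.2 i + L - p.2 ilast) : ℕ) : ℤ) := by
        push_cast
        rw [Finset.sum_congr rfl fun i _ => hcast (p.1 i) (hnear i).1.1,
          Finset.sum_congr rfl fun i _ => hcast (p.2 i) (hnear i).2.1]
        simp only [Finset.sum_sub_distrib, Finset.sum_add_distrib]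
        have : ((∑ i, p.1 i : ℕ) : ℤ) = ((∑ i, p.2 i : ℕ) : ℤ) := by exact_mod_cast hpb
        push_cast at this
        rw [this]
      exact_mod_cast h1
    · show p.2 ilast + L - p.2 ilast = L
      omega
  · -- termwise comparison
    intro p hp
    obtain ⟨-, -, hnear, hbig⟩ := hmem p hp
    have h1 : ∀ i, p.2 ilast - L + (p.1 i + L - p.2 ilast) = p.1 i := by
      intro i; have := (hnear i).1; have := (hbig ilast).2; omega
    have h2 : ∀ i, p.2 ilast - L + (p.2 i + L - p.2 ilast) = p.2 i := by
      intro i; have := (hnear i).2; have := (hbig ilast).2; omega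
    simp only [hφ, hg, hf, h1, h2]
    exact mul_le_mul (Finset.prod_le_prod (fun i _ => hv0 _) fun i _ => hvΛ _)
      (Finset.prod_le_prod (fun i _ => hv0 _) fun i _ => hvΛ _)
      (Finset.prod_nonneg fun i _ => hv0 _) (Finset.prod_nonneg fun i _ => hΛ0 _)


/-! ### Prime powers with a small least prime factor -/

/-- The prime powers `v ≤ N` with least prime factor `≤ R` number at most `(R + 1)(log₂ N + 1)`
(`v ↦ (minFac v, v.factorization (minFac v))` is injective on prime powers). [folklore] -/
theorem card_primePow_minFac_le (N R : ℕ) :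
    #((range (N + 1)).filter fun v => IsPrimePow v ∧ v.minFac ≤ R) ≤ (R + 1) * (Nat.log 2 N + 1) := by
  classical
  set S := (range (N + 1)).filter fun v => IsPrimePow v ∧ v.minFac ≤ R with hS
  have hinj : Set.InjOn (fun v => (v.minFac, v.factorization v.minFac)) (S : Set ℕ) := by
    intro v hv v' hv' h
    simp only [Prod.mk.injEq] at h
    have h1 := (Finset.mem_filter.1 hv).2.1.minFac_pow_factorization_eq
    have h2 := (Finset.mem_filter.1 hv').2.1.minFac_pow_factorization_eq
    calc v = v.minFac ^ v.factorization v.minFac := h1.symm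
      _ = v'.minFac ^ v'.factorization v'.minFac := by rw [h.2, h.1]
      _ = v' := h2
  have hmt : Set.MapsTo (fun v => (v.minFac, v.factorization v.minFac)) (S : Set ℕ)
      (((range (R + 1)) ×ˢ (range (Nat.log 2 N + 1)) : Finset (ℕ × ℕ)) : Set (ℕ × ℕ)) := by
    intro v hv
    have hv' := Finset.mem_filter.1 hv
    have hvN := Finset.mem_range.1 hv'.1
    have hpp := hv'.2.1
    have hR := hv'.2.2
    simp only [Finset.coe_product, Set.mem_prod, Finset.mem_coe, Finset.mem_range]
    refine ⟨by omega, ?_⟩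
    have hk := hpp.minFac_pow_factorization_eq
    have h2 : 2 ≤ v.minFac := (Nat.minFac_prime hpp.ne_one).two_le
    have h3 : 2 ^ (v.factorization v.minFac) ≤ N := by
      calc 2 ^ (v.factorization v.minFac) ≤ v.minFac ^ (v.factorization v.minFac) :=
            Nat.pow_le_pow_left h2 _
        _ = v := hk
        _ ≤ N := by omega
    have := Nat.le_log_of_pow_le (by norm_num) h3
    omega
  calc #S ≤ #((range (R + 1)) ×ˢ (range (Nat.log 2 N + 1))) :=
        Finset.card_le_card_of_injOn _ hmt hinj
    _ = (R + 1) * (Nat.log 2 N + 1) := by simp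

/-- A prime power `v ≤ N` which is not a prime exceeding `√N` has least prime factor `≤ √N`.
[folklore] -/
theorem minFac_le_sqrt_of_not_good {v N : ℕ} (hv : IsPrimePow v) (hvN : v ≤ N)
    (h : ¬ (v.Prime ∧ (N : ℝ) ^ (1 / 2 : ℝ) < v)) : v.minFac ≤ Nat.sqrt N := by
  rw [Nat.le_sqrt']
  by_cases hp : v.Prime
  · have hle : (v : ℝ) ≤ (N : ℝ) ^ (1 / 2 : ℝ) := not_lt.1 fun hlt => h ⟨hp, hlt⟩
    rw [hp.minFac_eq]
    have h0 : (0 : ℝ) ≤ v := Nat.cast_nonneg _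
    have : ((v ^ 2 : ℕ) : ℝ) ≤ N := by
      calc ((v ^ 2 : ℕ) : ℝ) = (v : ℝ) ^ 2 := by push_cast; ring
        _ ≤ ((N : ℝ) ^ (1 / 2 : ℝ)) ^ 2 := pow_le_pow_left₀ h0 hle 2
        _ = N := by
          rw [← Real.rpow_natCast, ← Real.rpow_mul (Nat.cast_nonneg _)]; norm_num
    exact_mod_cast this
  · obtain ⟨p, k, hpp, hk, rfl⟩ := hv
    rw [← Nat.prime_iff] at hpp
    have hk2 : 2 ≤ k := by
      by_contra hlt
      have hk1 : k = 1 := by omega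
      subst hk1
      exact hp (by simpa using hpp)
    rw [hpp.pow_minFac (by omega)]
    calc p ^ 2 ≤ p ^ k := Nat.pow_le_pow_right hpp.pos hk2
      _ ≤ N := hvN

/-! ### Products of von Mangoldt functions along shifts -/

/-- `∏_q Λ(n + y_q) ≤ (log N)^{#ι}` when `1 ≤ n + y_q ≤ N`. [folklore] -/
theorem prod_vonMangoldt_le_pow_log {ι : Type*} [Fintype ι] (y : ι → ℕ) (n N : ℕ)
    (hy : ∀ q, 1 ≤ n + y q ∧ n + y q ≤ N) :
    ∏ q, (Λ (n + y q) : ℝ) ≤ Real.log N ^ Fintype.card ι := by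
  calc ∏ q, (Λ (n + y q) : ℝ) ≤ ∏ _q : ι, Real.log N :=
        Finset.prod_le_prod (fun q _ => ArithmeticFunction.vonMangoldt_nonneg) fun q _ =>
          ArithmeticFunction.vonMangoldt_le_log.trans
            (Real.log_le_log (by exact_mod_cast (hy q).1) (by exact_mod_cast (hy q).2))
    _ = Real.log N ^ Fintype.card ι := by rw [Finset.prod_const, Finset.card_univ]

/-- If some `n + y_q` is not a prime power, `∏_q Λ(n + y_q) = 0`. [folklore] -/
theorem prod_vonMangoldt_eq_zero {ι : Type*} [Fintype ι] (y : ι → ℕ) (n : ℕ) {q : ι}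
    (hq : ¬ IsPrimePow (n + y q)) : ∏ q, (Λ (n + y q) : ℝ) = 0 :=
  Finset.prod_eq_zero (Finset.mem_univ q) (ArithmeticFunction.vonMangoldt_eq_zero_iff.2 hq)

/-! ### The upper-bound sieve for prime translates -/

/-- **Lemma 2.3 of [LichtmanTeravainen2022] in crude uniform form** (from the tree's
`uniformRoughTupleBound`, the upper-bound sieve for rough values of linear forms): for every `s`
there are `C, N₀` such that for `N ≥ N₀` and every set `T` of `s` shifts `≤ N`,
`#{n ≤ N : n + z is a prime > √N for all z ∈ T} ≤ C (log log N)^s N / (log N)^s`.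
[cite: LichtmanTeravainen2022, Lemma 2.3] -/
theorem card_primeTranslates_le (s : ℕ) :
    ∃ (C : ℝ) (N₀ : ℕ), ∀ N : ℕ, N₀ ≤ N → ∀ T : Finset ℕ, #T = s → (∀ z ∈ T, z ≤ N) →
      (#((range (N + 1)).filter fun n =>
          ∀ z ∈ T, (n + z).Prime ∧ (N : ℝ) ^ (1 / 2 : ℝ) < ((n + z : ℕ) : ℝ)) : ℝ) ≤
        C * Real.log (Real.log N) ^ s * N / Real.log N ^ s := by
  classical
  obtain ⟨C, N₀, hC⟩ := uniformRoughTupleBound s (2 * s) 2 (by norm_num)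
  refine ⟨C, N₀, fun N hN T hT hTN => ?_⟩
  -- enumerate `T`
  set e : Fin s ↪o ℕ := T.orderEmbOfFin hT with he
  have he_mem : ∀ k, e k ∈ T := fun k => T.orderEmbOfFin_mem hT k
  have he_inj : Function.Injective e := e.injective
  -- the system of translates
  set Φ : Fin s → AffLinForm 1 := fun k => ⟨fun _ => 1, (e k : ℤ)⟩ with hΦ
  have heval : ∀ k (m : ℤ), (Φ k).eval (fun _ => m) = m + e k := by
    intro k m
    simp [hΦ, AffLinForm.eval]
  have hnd : IsNondegenerateSystem Φ := by
    refine ⟨fun k h => ?_, fun i j hij a b hab => ?_⟩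
    · have := congrFun h 0
      simp [hΦ] at this
    · have h0 := hab (fun _ => 0)
      have h1 := hab (fun _ => 1)
      rw [heval, heval] at h0 h1
      have hab' : a = b := by linarith
      subst hab'
      have hne : (e i : ℤ) ≠ e j := by
        intro h; exact hij (he_inj (by exact_mod_cast h))
      have : a * ((e i : ℤ) - e j) = 0 := by linarith
      rcases mul_eq_zero.1 this with h | h
      · exact ⟨h, h⟩
      · exact absurd (sub_eq_zero.1 h) hne
  have hsize : affLinSize Φ N ≤ ((2 * s : ℕ) : ℝ) := by
    have h1 : ∀ k, |((e k : ℕ) : ℝ) / N| ≤ 1 := by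
      intro k
      rw [abs_of_nonneg (by positivity)]
      exact div_le_one_of_le₀ (by exact_mod_cast hTN _ (he_mem k)) (Nat.cast_nonneg _)
    have hA : ∑ i : Fin s, ∑ j : Fin 1, |(((Φ i).coeff j : ℤ) : ℝ)| = s := by
      simp [hΦ]
    have hB : ∑ i : Fin s, |(((Φ i).const : ℤ) : ℝ) / N| ≤ s := by
      calc ∑ i : Fin s, |(((Φ i).const : ℤ) : ℝ) / N| = ∑ k : Fin s, |((e k : ℕ) : ℝ) / N| := by
            simp [hΦ]
        _ ≤ ∑ _k : Fin s, (1 : ℝ) := Finset.sum_le_sum fun k _ => h1 k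
        _ = s := by simp
    unfold affLinSize
    rw [hA]
    calc (s : ℝ) + ∑ i : Fin s, |(((Φ i).const : ℤ) : ℝ) / N| ≤ s + s := by linarith
      _ = ((2 * s : ℕ) : ℝ) := by push_cast; ring
  have hmain := hC N hN Φ hnd hsize
  -- inject our set into the sieve's set
  refine le_trans ?_ hmain
  have hinj : Set.InjOn (fun n : ℕ => (fun _ : Fin 1 => (n : ℤ)))
      (((range (N + 1)).filter fun n =>
        ∀ z ∈ T, (n + z).Prime ∧ (N : ℝ) ^ (1 / 2 : ℝ) < ((n + z : ℕ) : ℝ)) : Set ℕ) := by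
    intro n _ n' _ h
    have h0 : (n : ℤ) = n' := congrFun h 0
    exact_mod_cast h0
  have hmt : Set.MapsTo (fun n : ℕ => (fun _ : Fin 1 => (n : ℤ)))
      (((range (N + 1)).filter fun n =>
        ∀ z ∈ T, (n + z).Prime ∧ (N : ℝ) ^ (1 / 2 : ℝ) < ((n + z : ℕ) : ℝ)) : Set ℕ)
      (((latticeBox 1 N).filter fun n =>
        ∀ k, (N : ℝ) ^ ((1 : ℝ) / 2) < (Nat.minFac ((Φ k).eval n).toNat : ℝ)) : Set (Fin 1 → ℤ)) := by
    intro n hn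
    have hn' := Finset.mem_filter.1 hn
    have hnN := Finset.mem_range.1 hn'.1
    simp only [Finset.coe_filter, Set.mem_setOf_eq, latticeBox, Fintype.mem_piFinset, Finset.mem_Icc]
    refine ⟨fun _ => ⟨by omega, by exact_mod_cast (by omega : n ≤ N)⟩, fun k => ?_⟩
    rw [heval]
    have hk := hn'.2 (e k) (he_mem k)
    have hcast : ((n : ℤ) + (e k : ℕ)).toNat = n + e k := by
      have : ((n : ℤ) + (e k : ℕ)) = ((n + e k : ℕ) : ℤ) := by push_cast; ring
      rw [this, Int.toNat_natCast]
    rw [hcast, hk.1.minFac_eq, one_div]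
    have := hk.2
    rw [one_div] at this
    exact this
  exact_mod_cast Finset.card_le_card_of_injOn _ hmt hinj

/-! ### The lower-order (prime power) term is eventually small -/

/-- For `X ≥ X₂(M)`: `(log 2X)^M · M · (√(2X) + 1)(log₂(2X) + 1) ≤ X`. [folklore] -/
theorem exists_bad_term_le (M : ℕ) : ∃ X₂ : ℕ, ∀ X : ℕ, X₂ ≤ X →
    Real.log ((2 * X : ℕ) : ℝ) ^ M *
        ((M : ℝ) * (((Nat.sqrt (2 * X) + 1) * (Nat.log 2 (2 * X) + 1) : ℕ) : ℝ)) ≤ X := by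
  -- `(log x)^{M+1} = o(x^{1/2})`
  have hlo := isLittleO_log_rpow_rpow_atTop (s := 1 / 2) ((M + 1 : ℕ) : ℝ) (by norm_num)
  set K : ℝ := 18 * (M + 1) * 2 ^ M with hK
  have hK0 : 0 < K := by rw [hK]; positivity
  have hb := hlo.bound (inv_pos.2 hK0)
  rw [Filter.eventually_atTop] at hb
  obtain ⟨x₀, hx₀⟩ := hb
  refine ⟨max 2 ⌈x₀⌉₊, fun X hX => ?_⟩
  have hX2 : 2 ≤ X := le_trans (le_max_left _ _) hX
  have hXx : x₀ ≤ (X : ℝ) := (Nat.le_ceil x₀).trans (by exact_mod_cast le_trans (le_max_right _ _) hX)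
  have hXr : (2 : ℝ) ≤ X := by exact_mod_cast hX2
  have hX0 : (0 : ℝ) < X := by linarith
  -- the little-o bound at `X`
  have h1 := hx₀ X hXx
  rw [Real.norm_of_nonneg (Real.rpow_nonneg (Real.log_nonneg (by linarith)) _),
    Real.norm_of_nonneg (Real.rpow_nonneg hX0.le _), Real.rpow_natCast] at h1
  -- `(log X)^{M+1} ≤ K⁻¹ X^{1/2}` hence `K (log X)^{M+1} ≤ √X`
  have hsqrt : (X : ℝ) ^ (1 / 2 : ℝ) = Real.sqrt X := (Real.sqrt_eq_rpow _).symm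
  rw [hsqrt] at h1
  have h2 : K * Real.log X ^ (M + 1) ≤ Real.sqrt X := by
    rw [← le_div_iff₀' hK0]; rw [div_eq_inv_mul] ; exact h1
  -- elementary bounds
  have hlogX1 : Real.log 2 ≤ Real.log X := Real.log_le_log (by norm_num) hXr
  have hlog2 : (1 / 2 : ℝ) < Real.log 2 := by have := Real.log_two_gt_d9; linarith
  have hlogX : 1 / 2 < Real.log X := lt_of_lt_of_le hlog2 hlogX1
  have hN : ((2 * X : ℕ) : ℝ) = 2 * X := by push_cast; ring
  have hlogN : Real.log ((2 * X : ℕ) : ℝ) ≤ 2 * Real.log X := by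
    rw [hN, Real.log_mul (by norm_num) hX0.ne']; linarith
  have hlogN0 : 0 ≤ Real.log ((2 * X : ℕ) : ℝ) := Real.log_nonneg (by rw [hN]; linarith)
  have hlogN1 : 1 ≤ Real.log ((2 * X : ℕ) : ℝ) := by
    rw [hN, Real.log_mul (by norm_num) hX0.ne']; linarith
  -- `Nat.sqrt (2X) + 1 ≤ 3 √X`
  have hs1 : 1 ≤ Real.sqrt X := by
    rw [show (1 : ℝ) = Real.sqrt 1 by simp]; exact Real.sqrt_le_sqrt (by linarith)
  have hsq : ((Nat.sqrt (2 * X) + 1 : ℕ) : ℝ) ≤ 3 * Real.sqrt X := by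
    have h3 : ((Nat.sqrt (2 * X) : ℕ) : ℝ) ≤ Real.sqrt ((2 * X : ℕ) : ℝ) := Real.nat_sqrt_le_real_sqrt
    have h4 : Real.sqrt ((2 * X : ℕ) : ℝ) ≤ 2 * Real.sqrt X := by
      rw [hN, Real.sqrt_mul (by norm_num), show (2 : ℝ) = Real.sqrt 4 by
        rw [show (4 : ℝ) = 2 ^ 2 by norm_num, Real.sqrt_sq (by norm_num)]]
      gcongr; norm_num
    push_cast; linarith
  -- `Nat.log 2 (2X) + 1 ≤ 3 log(2X) ≤ 6 log X`
  have hlg : ((Nat.log 2 (2 * X) + 1 : ℕ) : ℝ) ≤ 6 * Real.log X := by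
    have h3 : ((Nat.log 2 (2 * X) : ℕ) : ℝ) ≤ Real.logb 2 ((2 * X : ℕ) : ℝ) := by
      have := Real.natLog_le_logb (2 * X) 2
      exact_mod_cast this
    have h4 : Real.logb 2 ((2 * X : ℕ) : ℝ) ≤ 2 * Real.log ((2 * X : ℕ) : ℝ) := by
      rw [Real.logb, div_le_iff₀ (by linarith)]
      nlinarith
    push_cast; linarith
  -- combine
  have hlogXM : Real.log ((2 * X : ℕ) : ℝ) ^ M ≤ (2 * Real.log X) ^ M :=
    pow_le_pow_left₀ hlogN0 hlogN M
  have hlx0 : 0 ≤ Real.log X := by linarith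
  calc Real.log ((2 * X : ℕ) : ℝ) ^ M *
        ((M : ℝ) * (((Nat.sqrt (2 * X) + 1) * (Nat.log 2 (2 * X) + 1) : ℕ) : ℝ))
      ≤ (2 * Real.log X) ^ M * ((M : ℝ) * ((3 * Real.sqrt X) * (6 * Real.log X))) := by
        have h7 : (((Nat.sqrt (2 * X) + 1) * (Nat.log 2 (2 * X) + 1) : ℕ) : ℝ) ≤
            (3 * Real.sqrt X) * (6 * Real.log X) := by
          push_cast
          have h5 : ((Nat.sqrt (2 * X) : ℕ) : ℝ) + 1 ≤ 3 * Real.sqrt X := by exact_mod_cast hsq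
          have h6 : ((Nat.log 2 (2 * X) : ℕ) : ℝ) + 1 ≤ 6 * Real.log X := by exact_mod_cast hlg
          exact mul_le_mul h5 h6 (by positivity) (by positivity)
        exact mul_le_mul hlogXM (mul_le_mul_of_nonneg_left h7 (Nat.cast_nonneg _))
          (by positivity) (by positivity)
    _ = (18 * M * 2 ^ M * Real.log X ^ (M + 1)) * Real.sqrt X := by ring
    _ ≤ (K * Real.log X ^ (M + 1)) * Real.sqrt X := by
        refine mul_le_mul_of_nonneg_right ?_ (Real.sqrt_nonneg _)
        refine mul_le_mul_of_nonneg_right ?_ (by positivity)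
        rw [hK]; nlinarith [pow_pos (show (0:ℝ) < 2 by norm_num) M]
    _ ≤ Real.sqrt X * Real.sqrt X := mul_le_mul_of_nonneg_right h2 (Real.sqrt_nonneg _)
    _ = X := Real.mul_self_sqrt hX0.le

/-! ### The correlation bound -/

set_option maxHeartbeats 400000 in
/-- **Coincidences cost a logarithm** (the role of Lemma 2.3 with Lemma 2.4 in the proof of
[LichtmanTeravainen2022, Prop. 2.7], display (2.9)): for every `M` there are `C, X₀` such that for
`X ≥ X₀` and every family `(y_q)_{q ∈ ι}` of `M` shifts in `[1, X]` taking `s` distinct values,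
`∑_{n ≤ X} ∏_q Λ(n + y_q) ≤ C X (log log X)^M (log X)^{M - s}`.  Proof: `∏ Λ ≤ (log 2X)^M`, the
product vanishes unless all `n + y_q` are prime powers; the `n` for which all `n + z` (`z` a value)
are primes `> √(2X)` are counted by `card_primeTranslates_le`, and the remaining `n` have some
`n + z` among the `≪ √X log X` prime powers with least prime factor `≤ √(2X)`.
[cite: LichtmanTeravainen2022, Proposition 2.7 (proof)] -/
theorem sum_prod_vonMangoldt_le_of_card_image (M : ℕ) :
    ∃ (C : ℝ) (X₀ : ℕ), 0 ≤ C ∧ ∀ X : ℕ, X₀ ≤ X →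
      ∀ {ι : Type} [Fintype ι] (y : ι → ℕ), Fintype.card ι = M →
        (∀ q, 1 ≤ y q ∧ y q ≤ X) →
        ∑ n ∈ range (X + 1), ∏ q, (Λ (n + y q) : ℝ) ≤
          C * X * Real.log (Real.log X) ^ M * Real.log X ^ (M - #(univ.image y)) := by
  classical
  choose Cs Ns hCs using fun s => card_primeTranslates_le s
  obtain ⟨X₂, hX₂⟩ := exists_bad_term_le M
  set C₁ : ℝ := ∑ s ∈ range (M + 1), max (Cs s) 0 with hC₁
  set N₁ : ℕ := ∑ s ∈ range (M + 1), Ns s with hN₁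
  set X₃ : ℕ := ⌈Real.exp (Real.exp 1)⌉₊ with hX₃
  have hC₁0 : 0 ≤ C₁ := Finset.sum_nonneg fun s _ => le_max_right _ _
  have hCsC₁ : ∀ s, s ≤ M → Cs s ≤ C₁ := fun s hs =>
    (le_max_left _ _).trans (Finset.single_le_sum (fun s _ => le_max_right (Cs s) 0)
      (Finset.mem_range.2 (by omega)))
  have hNsN₁ : ∀ s, s ≤ M → Ns s ≤ N₁ := fun s hs =>
    Finset.single_le_sum (fun s _ => Nat.zero_le (Ns s)) (Finset.mem_range.2 (by omega))
  refine ⟨2 * 4 ^ M * C₁ + 1, max (max N₁ X₂) (max X₃ 2), by positivity, ?_⟩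
  intro X hX ι _ y hM hy
  have hXN₁ : N₁ ≤ X := le_trans (le_trans (le_max_left _ _) (le_max_left _ _)) hX
  have hXX₂ : X₂ ≤ X := le_trans (le_trans (le_max_right _ _) (le_max_left _ _)) hX
  have hXX₃ : X₃ ≤ X := le_trans (le_trans (le_max_left _ _) (le_max_right _ _)) hX
  have hX2 : 2 ≤ X := le_trans (le_trans (le_max_right _ _) (le_max_right _ _)) hX
  have hXr : (2 : ℝ) ≤ X := by exact_mod_cast hX2
  have hX0 : (0 : ℝ) < X := by linarith
  -- logarithms
  have hee : Real.exp (Real.exp 1) ≤ X := (Nat.le_ceil _).trans (by exact_mod_cast hXX₃)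
  have hlogX : Real.exp 1 ≤ Real.log X := by
    rw [← Real.log_exp (Real.exp 1)]; exact Real.log_le_log (Real.exp_pos _) hee
  have hlogX1 : 1 ≤ Real.log X := le_trans (by linarith [Real.add_one_le_exp (1 : ℝ)]) hlogX
  have hllX : 1 ≤ Real.log (Real.log X) := by
    rw [← Real.log_exp 1]; exact Real.log_le_log (Real.exp_pos _) hlogX
  have hlog2 : Real.log 2 ≤ 1 := by
    have := Real.log_two_lt_d9; linarith
  have hlog2X : Real.log 2 ≤ Real.log X := Real.log_le_log (by norm_num) hXr
  set N : ℕ := 2 * X with hNdef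
  have hNr : (N : ℝ) = 2 * X := by rw [hNdef]; push_cast; ring
  have hlogN : Real.log N = Real.log 2 + Real.log X := by
    rw [hNr, Real.log_mul (by norm_num) hX0.ne']
  have hlogN_le : Real.log N ≤ 2 * Real.log X := by rw [hlogN]; linarith
  have hlogN1 : 1 ≤ Real.log N := by rw [hlogN]; linarith [Real.log_nonneg (by norm_num : (1:ℝ) ≤ 2)]
  have hlogN0 : 0 ≤ Real.log N := by linarith
  have hllN : Real.log (Real.log N) ≤ 2 * Real.log (Real.log X) := by
    calc Real.log (Real.log N) ≤ Real.log (2 * Real.log X) :=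
          Real.log_le_log (by linarith) hlogN_le
      _ = Real.log 2 + Real.log (Real.log X) := Real.log_mul (by norm_num) (by linarith)
      _ ≤ 2 * Real.log (Real.log X) := by linarith
  have hllN0 : 0 ≤ Real.log (Real.log N) := Real.log_nonneg hlogN1
  -- the distinct values
  set T : Finset ℕ := univ.image y with hT
  set s : ℕ := #T with hs
  have hsM : s ≤ M := by rw [hs, hT, ← hM]; exact Finset.card_image_le.trans (by simp)
  have hTX : ∀ z ∈ T, 1 ≤ z ∧ z ≤ X := by
    intro z hz; rw [hT, Finset.mem_image] at hz; obtain ⟨q, -, rfl⟩ := hz; exact hy q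
  -- pointwise bound
  set Bad : Finset ℕ := (range (N + 1)).filter fun v => IsPrimePow v ∧ v.minFac ≤ Nat.sqrt N with hBad
  set good : ℕ → Prop := fun n => ∀ z ∈ T, (n + z).Prime ∧ (N : ℝ) ^ (1 / 2 : ℝ) < ((n + z : ℕ) : ℝ)
    with hgood
  set badn : ℕ → Prop := fun n => ∃ z ∈ T, n + z ∈ Bad with hbadn
  have hpt : ∀ n ∈ range (X + 1), ∏ q, (Λ (n + y q) : ℝ) ≤
      Real.log N ^ M * ((if good n then 1 else 0) + (if badn n then 1 else 0)) := by
    intro n hn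
    have hnX : n ≤ X := by have := Finset.mem_range.1 hn; omega
    have hle : ∏ q, (Λ (n + y q) : ℝ) ≤ Real.log N ^ M := by
      rw [← hM]
      exact prod_vonMangoldt_le_pow_log y n N fun q => ⟨by have := (hy q).1; omega,
        by have := (hy q).2; rw [hNdef]; omega⟩
    have h0 : 0 ≤ ∏ q, (Λ (n + y q) : ℝ) :=
      Finset.prod_nonneg fun q _ => ArithmeticFunction.vonMangoldt_nonneg
    by_cases hall : ∀ q, IsPrimePow (n + y q)
    · by_cases hg : good n
      · rw [if_pos hg]
        calc ∏ q, (Λ (n + y q) : ℝ) ≤ Real.log N ^ M := hle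
          _ ≤ Real.log N ^ M * (1 + if badn n then 1 else 0) := by
            have : (1 : ℝ) ≤ 1 + if badn n then 1 else 0 := by split_ifs <;> norm_num
            nlinarith [pow_nonneg hlogN0 M]
      · -- some value `z = y q` is not a big prime, hence a bad prime power
        have hb : badn n := by
          simp only [hgood, not_forall, exists_prop] at hg
          obtain ⟨z, hz, hzg⟩ := hg
          refine ⟨z, hz, ?_⟩
          have hz' : ∃ q, y q = z := by
            rw [hT, Finset.mem_image] at hz; obtain ⟨q, -, hq⟩ := hz; exact ⟨q, hq⟩
          obtain ⟨q, rfl⟩ := hz'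
          have hpp := hall q
          simp only [hBad, Finset.mem_filter, Finset.mem_range]
          refine ⟨by have := (hy q).2; rw [hNdef]; omega, hpp, ?_⟩
          exact minFac_le_sqrt_of_not_good hpp (by have := (hy q).2; rw [hNdef]; omega) hzg
        rw [if_pos hb]
        calc ∏ q, (Λ (n + y q) : ℝ) ≤ Real.log N ^ M := hle
          _ ≤ Real.log N ^ M * ((if good n then 1 else 0) + 1) := by
            have : (1 : ℝ) ≤ (if good n then 1 else 0) + 1 := by rw [if_neg hg]; norm_num
            nlinarith [pow_nonneg hlogN0 M]
    · simp only [not_forall] at hall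
      obtain ⟨q, hq⟩ := hall
      rw [prod_vonMangoldt_eq_zero y n hq]
      have : (0 : ℝ) ≤ (if good n then 1 else 0) + (if badn n then 1 else 0) := by
        split_ifs <;> norm_num
      positivity
  -- sum the pointwise bound
  have hsum : ∑ n ∈ range (X + 1), ∏ q, (Λ (n + y q) : ℝ) ≤
      Real.log N ^ M * ((#((range (X + 1)).filter good) : ℝ) + #((range (X + 1)).filter badn)) := by
    refine (Finset.sum_le_sum hpt).trans (le_of_eq ?_)
    rw [← Finset.mul_sum, Finset.sum_add_distrib, Finset.sum_boole, Finset.sum_boole]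
  -- the good `n`
  have hgood_le : (#((range (X + 1)).filter good) : ℝ) ≤
      C₁ * Real.log (Real.log N) ^ s * N / Real.log N ^ s := by
    have hsub : (range (X + 1)).filter good ⊆ (range (N + 1)).filter good := by
      intro n hn
      simp only [Finset.mem_filter, Finset.mem_range] at hn ⊢
      exact ⟨by rw [hNdef]; omega, hn.2⟩
    have hN : Ns s ≤ N := by have := hNsN₁ s hsM; rw [hNdef]; omega
    have h1 := hCs s N hN T hs.symm fun z hz => by have := (hTX z hz).2; rw [hNdef]; omega
    calc (#((range (X + 1)).filter good) : ℝ) ≤ #((range (N + 1)).filter good) := by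
          exact_mod_cast Finset.card_le_card hsub
      _ ≤ Cs s * Real.log (Real.log N) ^ s * N / Real.log N ^ s := h1
      _ ≤ C₁ * Real.log (Real.log N) ^ s * N / Real.log N ^ s := by
          have : 0 ≤ Real.log (Real.log N) ^ s * N / Real.log N ^ s := by positivity
          calc Cs s * Real.log (Real.log N) ^ s * N / Real.log N ^ s
              = Cs s * (Real.log (Real.log N) ^ s * N / Real.log N ^ s) := by ring
            _ ≤ C₁ * (Real.log (Real.log N) ^ s * N / Real.log N ^ s) :=
                mul_le_mul_of_nonneg_right (hCsC₁ s hsM) this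
            _ = C₁ * Real.log (Real.log N) ^ s * N / Real.log N ^ s := by ring
  -- the bad `n`
  have hbad_le : (#((range (X + 1)).filter badn) : ℝ) ≤
      (M : ℝ) * (((Nat.sqrt N + 1) * (Nat.log 2 N + 1) : ℕ) : ℝ) := by
    have h1 : (range (X + 1)).filter badn ⊆ T.biUnion fun z => (range (X + 1)).filter fun n => n + z ∈ Bad := by
      intro n hn
      simp only [Finset.mem_filter, hbadn] at hn
      obtain ⟨hn1, z, hz, hzB⟩ := hn
      exact Finset.mem_biUnion.2 ⟨z, hz, Finset.mem_filter.2 ⟨hn1, hzB⟩⟩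
    have h2 : ∀ z ∈ T, #((range (X + 1)).filter fun n => n + z ∈ Bad) ≤ #Bad := by
      intro z _
      refine Finset.card_le_card_of_injOn (fun n => n + z) (fun n hn => ?_) ?_
      · exact (Finset.mem_filter.1 hn).2
      · intro n _ n' _ h; simpa using h
    have h3 : #Bad ≤ (Nat.sqrt N + 1) * (Nat.log 2 N + 1) := card_primePow_minFac_le N (Nat.sqrt N)
    calc (#((range (X + 1)).filter badn) : ℝ)
        ≤ #(T.biUnion fun z => (range (X + 1)).filter fun n => n + z ∈ Bad) := by
          exact_mod_cast Finset.card_le_card h1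
      _ ≤ ∑ z ∈ T, (#((range (X + 1)).filter fun n => n + z ∈ Bad) : ℝ) := by
          exact_mod_cast Finset.card_biUnion_le
      _ ≤ ∑ _z ∈ T, (((Nat.sqrt N + 1) * (Nat.log 2 N + 1) : ℕ) : ℝ) :=
          Finset.sum_le_sum fun z hz => by exact_mod_cast (h2 z hz).trans h3
      _ = s * (((Nat.sqrt N + 1) * (Nat.log 2 N + 1) : ℕ) : ℝ) := by
          rw [Finset.sum_const, nsmul_eq_mul, hs]
      _ ≤ (M : ℝ) * (((Nat.sqrt N + 1) * (Nat.log 2 N + 1) : ℕ) : ℝ) := by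
          gcongr
  -- final algebra
  have hbadX : Real.log N ^ M * ((M : ℝ) * (((Nat.sqrt N + 1) * (Nat.log 2 N + 1) : ℕ) : ℝ)) ≤ X :=
    hX₂ X hXX₂
  have hfac : Real.log (Real.log X) ^ M * Real.log X ^ (M - s) ≥ 1 := by
    have h1 : 1 ≤ Real.log (Real.log X) ^ M := one_le_pow₀ hllX
    have h2 : 1 ≤ Real.log X ^ (M - s) := one_le_pow₀ hlogX1
    nlinarith
  have hmainterm : Real.log N ^ M * (C₁ * Real.log (Real.log N) ^ s * N / Real.log N ^ s) ≤
      2 * 4 ^ M * C₁ * X * (Real.log (Real.log X) ^ M * Real.log X ^ (M - s)) := by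
    -- `(log N)^M / (log N)^s = (log N)^{M-s} ≤ (2 log X)^{M-s} ≤ 2^M (log X)^{M-s}`
    have hpow : Real.log N ^ M / Real.log N ^ s = Real.log N ^ (M - s) := by
      rw [div_eq_iff (pow_ne_zero _ (by linarith)), ← pow_add, Nat.sub_add_cancel hsM]
    have h1 : Real.log N ^ (M - s) ≤ 2 ^ M * Real.log X ^ (M - s) := by
      calc Real.log N ^ (M - s) ≤ (2 * Real.log X) ^ (M - s) := pow_le_pow_left₀ hlogN0 hlogN_le _
        _ = 2 ^ (M - s) * Real.log X ^ (M - s) := mul_pow _ _ _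
        _ ≤ 2 ^ M * Real.log X ^ (M - s) := by
          refine mul_le_mul_of_nonneg_right (pow_le_pow_right₀ (by norm_num) (Nat.sub_le M s))
            (pow_nonneg (by linarith) _)
    -- `(log log N)^s ≤ (2 log log X)^s ≤ (2 log log X)^M = 2^M (log log X)^M`
    have h2 : Real.log (Real.log N) ^ s ≤ 2 ^ M * Real.log (Real.log X) ^ M := by
      calc Real.log (Real.log N) ^ s ≤ (2 * Real.log (Real.log X)) ^ s := pow_le_pow_left₀ hllN0 hllN s
        _ ≤ (2 * Real.log (Real.log X)) ^ M := pow_le_pow_right₀ (by linarith) hsM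
        _ = 2 ^ M * Real.log (Real.log X) ^ M := mul_pow _ _ _
    have hllX0 : 0 ≤ Real.log (Real.log X) := by linarith
    calc Real.log N ^ M * (C₁ * Real.log (Real.log N) ^ s * N / Real.log N ^ s)
        = C₁ * Real.log (Real.log N) ^ s * N * (Real.log N ^ M / Real.log N ^ s) := by ring
      _ = C₁ * Real.log (Real.log N) ^ s * (2 * X) * Real.log N ^ (M - s) := by rw [hpow, hNr]
      _ ≤ C₁ * (2 ^ M * Real.log (Real.log X) ^ M) * (2 * X) * (2 ^ M * Real.log X ^ (M - s)) := by
          have hA : 0 ≤ C₁ * Real.log (Real.log N) ^ s * (2 * X) := by positivity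
          calc C₁ * Real.log (Real.log N) ^ s * (2 * X) * Real.log N ^ (M - s)
              ≤ C₁ * Real.log (Real.log N) ^ s * (2 * X) * (2 ^ M * Real.log X ^ (M - s)) :=
                mul_le_mul_of_nonneg_left h1 hA
            _ ≤ C₁ * (2 ^ M * Real.log (Real.log X) ^ M) * (2 * X) * (2 ^ M * Real.log X ^ (M - s)) := by
                have hB : 0 ≤ (2 * (X : ℝ)) * (2 ^ M * Real.log X ^ (M - s)) := by positivity
                have := mul_le_mul_of_nonneg_left h2 hC₁0
                nlinarith
      _ = 2 * 4 ^ M * C₁ * X * (Real.log (Real.log X) ^ M * Real.log X ^ (M - s)) := by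
          rw [show (4 : ℝ) ^ M = 2 ^ M * 2 ^ M by rw [← mul_pow]; norm_num]; ring
  calc ∑ n ∈ range (X + 1), ∏ q, (Λ (n + y q) : ℝ)
      ≤ Real.log N ^ M * ((#((range (X + 1)).filter good) : ℝ) + #((range (X + 1)).filter badn)) := hsum
    _ ≤ Real.log N ^ M * (C₁ * Real.log (Real.log N) ^ s * N / Real.log N ^ s) +
        Real.log N ^ M * ((M : ℝ) * (((Nat.sqrt N + 1) * (Nat.log 2 N + 1) : ℕ) : ℝ)) := by
          rw [← mul_add]
          exact mul_le_mul_of_nonneg_left (add_le_add hgood_le hbad_le) (pow_nonneg hlogN0 M)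
    _ ≤ 2 * 4 ^ M * C₁ * X * (Real.log (Real.log X) ^ M * Real.log X ^ (M - s)) +
        X * (Real.log (Real.log X) ^ M * Real.log X ^ (M - s)) := by
          refine add_le_add hmainterm (hbadX.trans ?_)
          nlinarith
    _ = (2 * 4 ^ M * C₁ + 1) * X * Real.log (Real.log X) ^ M * Real.log X ^ (M - #(univ.image y)) := by
          rw [← hT, ← hs]; ring

end Literature.NumberTheory.Sieve.LichtmanTeravainen2022
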